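import Literature.AnabelianGeometry.SemiGraphs.PSCCompactifiedLevelBridgeNodes
import Literature.AnabelianGeometry.SemiGraphs.PSCCoveringBranchData
import HarnessLib

/-!
# [CombGC] Thm. 1.6 (ii), descent step for the NODES along ARBITRARY presentations of `Π^cpt` of the
# coverings `G.restrictBD U`, `H.restrictBD U'`: from "`ᾱ_U` group-theoretically edge-like" to the
# "graphic modulo `Ker(↠ Π^cpt)`" node correspondence

Mochizuki, *A combinatorial version of the Grothendieck conjecture*, Tohoku Math. J. **59** (2007) [CombGC],
proof of Theorem 1.6 (ii), author's ms p. 14 l.18–24 ("by replacing `G`, `H` by their respective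
compactifications … we may assume noncuspidal … by Remark 1.4.4, the assumption that `α` is edge-wise
filtration-preserving implies that `α` is group-theoretically edge-like"), render `paper:url-6994f81053dc`
p0014; Prop. 1.2 (i) p. 8. [cite: MochizukiCombGC2007, Thm 1.6(ii) p.14]

PROOF-ONLY file (abc-iut cell, layer L3, `plan/L3/SUBDAG-CombGC-Thm16.md` row T16-L09b; writer's request
05:22:11Z: consumer-facing bridges phrased for `restrictBD … bd` with ARBITRARY branch data `bd` and for
`compactifyAlong` along ARBITRARY presentations `f : Π_{G_U} ↠ Q` with `ker f = Ker(↠ Π^cpt)`, the input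
being "`ᾱ_U` GROUP-THEORETICALLY EDGE-LIKE" (the output of the writer's producer
`exists_compactified_gtEdgeLike_holds`) rather than a graphic `ι`; holder abc-iut-w5-d188).  Contents:
* §1 pull-back `Z ↦ (Z.comap f').map U'.subtype` along a SURJECTIVE presentation `f' : Π_{H_{U'}} ↠ Q'`:
  injective, `Q'`-conjugation by `f' u` ↦ `U'`-conjugation by `u`, images ↦ `· ⊔ (ker f')↑`, and
  `ᾱ`(images) ↦ `α(·) ⊔ (ker f')↑` for `ᾱ : Q ≅ Q'` over `α|_U`;
* §2 `restrictBD_cptKer` (rfl), `map_subtype_ker_normal` (`(ker f')↑ = Ker(Π_{H_{U'}} ↠ Π^cpt)↑` is normal in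
  `Π_H`, from p423150), `map_ker_eq_of_over` (`α((ker f)↑) = (ker f')↑`);
* §3 **`matched_node_of_gtEdgeLike`** / **`matched_node_of_gtEdgeLike'`** — `ᾱ_U` group-theoretically
  edge-like between `(G_U).compactifyAlong f` and `(H_{U'}).compactifyAlong f'` ⇒ every node `U x Π_e` of `G_U`
  is matched to a node `U' y Π_{e'}` of `H_{U'}` with `α(U ⊓ Π_e^x) ⊔ K'↑` a `U'`-conjugate of
  `(U' ⊓ Π_{e'}^y) ⊔ K'↑`, and conversely; **`sep_nodes_mod_of_edgeLikeOpenInter_compactifyAlong`** — Prop. 1.2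
  (i) for the compactified covering (`EdgeLikeOpenInterDeterminesEdge`, at its nodes) ⇒ separation.
The PACKAGE (node bijection derived by choice; hypothesis of p423994 `nodal_transport_of_graphic_mod`) is
`PSCCompactifiedNodePackage.lean`.  Pure plumbing; no definitions; nothing here takes a side on
[IUTchIII] Cor. 3.12.
-/

noncomputable section

namespace Literature.AnabelianGeometry.SemiGraphs

namespace PSCDatum

open scoped Pointwise
open PSCCovering

universe u

variable {P : Type u} [Group P] [TopologicalSpace P]
variable {P' : Type u} [Group P'] [TopologicalSpace P']
variable {Q : Type u} [Group Q] [TopologicalSpace Q]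
variable {Q' : Type u} [Group Q'] [TopologicalSpace Q']

/-! ### 1. Pull-back along a surjective presentation `f' : U' ↠ Q'` -/

section PullF

variable (U' : Subgroup P') (f' : U' →* Q')

omit [TopologicalSpace P'] [TopologicalSpace Q'] in
/-- The pull-back `Z ↦ (Z.comap f').map U'.subtype` is injective for `f'` surjective.
[cite: MochizukiCombGC2007, Rmk 1.1.6 p.8] -/
theorem pullF_injective (hs' : Function.Surjective f') {Z₁ Z₂ : Subgroup Q'}
    (h : (Z₁.comap f').map U'.subtype = (Z₂.comap f').map U'.subtype) : Z₁ = Z₂ :=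
  Subgroup.comap_injective hs' (Subgroup.map_injective U'.subtype_injective h)

omit [TopologicalSpace P'] [TopologicalSpace Q'] in
/-- The pull-back carries conjugation by `f' u` to conjugation by `u`. [cite: MochizukiCombGC2007, Rmk 1.1.6 p.8] -/
theorem pullF_conj (u : U') (Z : Subgroup Q') :
    ((ConjAct.toConjAct (f' u) • Z).comap f').map U'.subtype =
      ConjAct.toConjAct (u : P') • (Z.comap f').map U'.subtype := by
  have hc : (ConjAct.toConjAct (f' u) • Z).comap f' = ConjAct.toConjAct u • Z.comap f' := by
    ext x
    rw [Subgroup.mem_comap, Subgroup.mem_pointwise_smul_iff_inv_smul_mem,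
      Subgroup.mem_pointwise_smul_iff_inv_smul_mem, Subgroup.mem_comap]
    simp only [ConjAct.smul_def, ← map_inv, ConjAct.ofConjAct_toConjAct, map_mul]
  rw [hc, map_conj_smul, ConjAct.ofConjAct_toConjAct]
  rfl

omit [TopologicalSpace P'] [TopologicalSpace Q'] in
/-- The pull-back of the image of `X ≤ U'` is `X↑ ⊔ (ker f')↑`. [cite: MochizukiCombGC2007, Rmk 1.1.6 p.8] -/
theorem pullF_map (X : Subgroup U') :
    ((X.map f').comap f').map U'.subtype = X.map U'.subtype ⊔ f'.ker.map U'.subtype := by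
  rw [Subgroup.comap_map_eq, Subgroup.map_sup]

variable {U'} {f'} {U : Subgroup P} {f : U →* Q}

omit [TopologicalSpace Q] [TopologicalSpace Q'] in
/-- For `ᾱ : Q ≅ Q'` over `αU : U ≅ U'` over `α : Π_G ≅ Π_H`: the pull-back of `ᾱ(f(X))` is `α(X↑) ⊔ (ker f')↑`.
[cite: MochizukiCombGC2007, Thm 1.6(ii) p.14] -/
theorem pullF_map_map (α : P ≃ₜ* P') (αU : U ≃ₜ* U') (hαU : ∀ u : U, ((αU u : U') : P') = α u)
    (ᾱ : Q ≃* Q') (hᾱ : ∀ u : U, ᾱ (f u) = f' (αU u)) (X : Subgroup U) :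
    (((X.map f).map ᾱ.toMonoidHom).comap f').map U'.subtype =
      (X.map U.subtype).map α.toMulEquiv.toMonoidHom ⊔ f'.ker.map U'.subtype := by
  have hsq : (X.map f).map ᾱ.toMonoidHom = (X.map αU.toMulEquiv.toMonoidHom).map f' := by
    rw [Subgroup.map_map, Subgroup.map_map]
    congr 1
    ext u
    exact hᾱ u
  rw [hsq, pullF_map, Subgroup.map_map, Subgroup.map_map]
  congr 2
  ext u
  exact hαU u

end PullF

/-! ### 2. Kernel bookkeeping for the coverings `restrictBD` -/

section Kernels

variable [IsTopologicalGroup P] [IsTopologicalGroup P']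
variable (G : PSCDatum P) (H : PSCDatum P') (α : P ≃ₜ* P')
variable (U : Subgroup P) [U.FiniteIndex] [U.Normal] (hU : IsOpen (U : Set P)) (bd : G.BranchData)
variable (U' : Subgroup P') [U'.FiniteIndex] [U'.Normal] (hU' : IsOpen (U' : Set P')) (bd' : H.BranchData)

omit [U.Normal] in
/-- `Ker(↠ Π^cpt)` of `G_U` does not depend on the branch data. [cite: MochizukiCombGC2007, Def 1.1(ii) p.7] -/
theorem restrictBD_cptKer : (G.restrictBD U hU bd).cptKer = (G.restrict U hU).cptKer := rfl

omit [TopologicalSpace Q'] in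
/-- For a presentation `f' : Π_{H_{U'}} ↠ Q'` of `Π^cpt` (`ker f' = Ker(↠ Π^cpt)`), `(ker f')↑` is normal in
`Π_H`. [cite: MochizukiCombGC2007, Def 1.1(ii) p.7] -/
theorem map_subtype_ker_normal {f' : U' →* Q'} (hk' : f'.ker = (H.restrictBD U' hU' bd').cptKer) :
    (f'.ker.map U'.subtype).Normal := by
  rw [hk', restrictBD_cptKer]
  exact H.map_subtype_cptKer_normal U' hU'

omit [TopologicalSpace Q] [TopologicalSpace Q'] [IsTopologicalGroup P] [IsTopologicalGroup P'] [U.FiniteIndex]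
  [U.Normal] [U'.FiniteIndex] [U'.Normal] in
/-- For `ᾱ : Q ≅ Q'` over `αU` (presentations `f`, `f'`): `α((ker f)↑) = (ker f')↑`.
[cite: MochizukiCombGC2007, Thm 1.6(ii) p.14] -/
theorem map_ker_eq_of_over {f : U →* Q} {f' : U' →* Q'} (αU : U ≃ₜ* U')
    (hαU : ∀ u : U, ((αU u : U') : P') = α u) (ᾱ : Q ≃* Q') (hᾱ : ∀ u : U, ᾱ (f u) = f' (αU u)) :
    (f.ker.map U.subtype).map α.toMulEquiv.toMonoidHom = f'.ker.map U'.subtype := by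
  apply le_antisymm
  · rintro _ ⟨_, ⟨u, hu, rfl⟩, rfl⟩
    refine ⟨αU u, ?_, (hαU u).symm ▸ rfl⟩
    rw [SetLike.mem_coe, MonoidHom.mem_ker, ← hᾱ, (MonoidHom.mem_ker).mp hu, map_one]
  · rintro _ ⟨u', hu', rfl⟩
    refine ⟨(αU.symm u' : U), ⟨αU.symm u', ?_, rfl⟩, ?_⟩
    · have h2 := hᾱ (αU.symm u')
      rw [ContinuousMulEquiv.apply_symm_apply, (MonoidHom.mem_ker).mp hu', ← map_one ᾱ] at h2
      exact (MonoidHom.mem_ker).mpr (ᾱ.injective h2)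
    · have := hαU (αU.symm u')
      rw [ContinuousMulEquiv.apply_symm_apply] at this
      exact this.symm

end Kernels

/-! ### 3. Matched nodes and separation, along arbitrary presentations of `Π^cpt` -/

section Level

variable [IsTopologicalGroup P] [IsTopologicalGroup P'] [T2Space Q] [T2Space Q']
variable (G : PSCDatum P) (H : PSCDatum P') (α : P ≃ₜ* P')
variable (U : Subgroup P) [U.FiniteIndex] [U.Normal] (hU : IsOpen (U : Set P)) (bd : G.BranchData)
variable (U' : Subgroup P') [U'.FiniteIndex] [U'.Normal] (hU' : IsOpen (U' : Set P')) (bd' : H.BranchData)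
variable [CompactSpace U] [CompactSpace U']
variable (f : U →* Q) (hf : Continuous f) (hs : Function.Surjective f)
variable (f' : U' →* Q') (hf' : Continuous f') (hs' : Function.Surjective f')
variable (hUU' : U.map α.toMulEquiv.toMonoidHom = U')
variable (αU : U ≃ₜ* U') (hαU : ∀ u : U, ((αU u : U') : P') = α u)
variable (ᾱ : Q ≃ₜ* Q') (hᾱ : ∀ u : U, ᾱ (f u) = f' (αU u))
variable (hk' : f'.ker = (H.restrictBD U' hU' bd').cptKer)

include hUU' hαU hᾱ hk' in
/-- **A group-theoretically edge-like `ᾱ_U` between the compactified coverings matches NODES modulo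
`Ker(↠ Π^cpt)↑`**: for every node `U x Π_e` of `G_U` there is a node `U' y Π_{e'}` of `H_{U'}` with
`α(U ⊓ Π_e^x) ⊔ K'↑` a `U'`-conjugate of `(U' ⊓ Π_{e'}^y) ⊔ K'↑` (the edge-like subgroups of a compactified
covering are the images of its nodal subgroups). [cite: MochizukiCombGC2007, Thm 1.6(ii) p.14] -/
theorem matched_node_of_gtEdgeLike
    (hge : ((G.restrictBD U hU bd).compactifyAlong f hf hs).IsGroupTheoreticallyEdgeLike
      ((H.restrictBD U' hU' bd').compactifyAlong f' hf' hs') ᾱ)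
    (e : G.graph.N) (x : P) :
    ∃ (e' : H.graph.N) (y : P'), ∃ u' ∈ U',
      (U ⊓ ConjAct.toConjAct x • G.nodeGp e).map α.toMulEquiv.toMonoidHom ⊔ f'.ker.map U'.subtype =
        ConjAct.toConjAct u' • ((U' ⊓ ConjAct.toConjAct y • H.nodeGp e') ⊔ f'.ker.map U'.subtype) := by
  have hKn : (f'.ker.map U'.subtype).Normal := map_subtype_ker_normal H U' hU' bd' hk'
  set X : (G.restrictGraphBD U bd).N := ⟨e, dcIdx U (G.nodeGp e) x⟩ with hX
  have hA : ((G.restrictBD U hU bd).compactifyAlong f hf hs).IsEdgeLike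
      (((G.restrictBD U hU bd).nodeGp X).map f) :=
    ((G.restrictBD U hU bd).isEdgeLike_compactifyAlong_iff f hf hs _).mpr
      ⟨(G.restrictBD U hU bd).nodeGp X, ⟨X, 1, (one_smul _ _).symm⟩, rfl⟩
  obtain ⟨B', ⟨⟨e₀, j₀⟩, γ', rfl⟩, hB'⟩ :=
    ((H.restrictBD U' hU' bd').isEdgeLike_compactifyAlong_iff f' hf' hs' _).mp (hge.1 _ hA)
  have hpull := congrArg (fun Z : Subgroup Q' => (Z.comap f').map U'.subtype) hB'
  rw [pullF_map_map α αU hαU ᾱ.toMulEquiv hᾱ, map_conj_smul, pullF_conj, pullF_map] at hpull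
  have hL : ((G.restrictBD U hU bd).nodeGp X).map U.subtype =
      U ⊓ ConjAct.toConjAct (G.nrep U ⟨e, dcIdx U (G.nodeGp e) x⟩) • G.nodeGp e := restrict_nodeGp_map hU _
  have hR : ((H.restrictBD U' hU' bd').nodeGp ⟨e₀, j₀⟩).map U'.subtype =
      U' ⊓ ConjAct.toConjAct (H.nrep U' ⟨e₀, j₀⟩) • H.nodeGp e₀ := restrict_nodeGp_map hU' _
  rw [hL, hR] at hpull
  obtain ⟨u₁, hu₁, h₁⟩ := G.exists_inf_nrep_smul_eq U e x
  rw [h₁, map_conj_smul, ← conjAct_smul_sup_of_normal hKn] at hpull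
  have hαu₁ : α u₁ ∈ U' := by rw [← hUU']; exact ⟨u₁, hu₁, rfl⟩
  refine ⟨e₀, H.nrep U' ⟨e₀, j₀⟩, (α u₁)⁻¹ * ((ConjAct.ofConjAct γ' : U') : P'),
    U'.mul_mem (U'.inv_mem hαu₁) (ConjAct.ofConjAct γ').2, ?_⟩
  rw [map_mul, map_inv, mul_smul, eq_inv_smul_iff]
  exact hpull

include hUU' hαU hᾱ hk' in
omit [U.Normal] in
/-- The converse matching (every node of `H_{U'}` is matched to a node of `G_U`).
[cite: MochizukiCombGC2007, Thm 1.6(ii) p.14] -/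
theorem matched_node_of_gtEdgeLike'
    (hge : ((G.restrictBD U hU bd).compactifyAlong f hf hs).IsGroupTheoreticallyEdgeLike
      ((H.restrictBD U' hU' bd').compactifyAlong f' hf' hs') ᾱ)
    (e' : H.graph.N) (y : P') :
    ∃ (e : G.graph.N) (x : P), ∃ u' ∈ U',
      (U ⊓ ConjAct.toConjAct x • G.nodeGp e).map α.toMulEquiv.toMonoidHom ⊔ f'.ker.map U'.subtype =
        ConjAct.toConjAct u' • ((U' ⊓ ConjAct.toConjAct y • H.nodeGp e') ⊔ f'.ker.map U'.subtype) := by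
  have hKn : (f'.ker.map U'.subtype).Normal := map_subtype_ker_normal H U' hU' bd' hk'
  set Y : (H.restrictGraphBD U' bd').N := ⟨e', dcIdx U' (H.nodeGp e') y⟩ with hY
  have hB : ((H.restrictBD U' hU' bd').compactifyAlong f' hf' hs').IsEdgeLike
      (((H.restrictBD U' hU' bd').nodeGp Y).map f') :=
    ((H.restrictBD U' hU' bd').isEdgeLike_compactifyAlong_iff f' hf' hs' _).mpr
      ⟨(H.restrictBD U' hU' bd').nodeGp Y, ⟨Y, 1, (one_smul _ _).symm⟩, rfl⟩
  obtain ⟨A, hA, hAB⟩ := hge.2 _ hB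
  obtain ⟨A₀, ⟨⟨e₀, i₀⟩, γ, rfl⟩, rfl⟩ :=
    ((G.restrictBD U hU bd).isEdgeLike_compactifyAlong_iff f hf hs _).mp hA
  have hpull := congrArg (fun Z : Subgroup Q' => (Z.comap f').map U'.subtype) hAB
  rw [pullF_map_map α αU hαU ᾱ.toMulEquiv hᾱ, map_conj_smul, map_conj_smul, pullF_map] at hpull
  have hL : ((G.restrictBD U hU bd).nodeGp ⟨e₀, i₀⟩).map U.subtype =
      U ⊓ ConjAct.toConjAct (G.nrep U ⟨e₀, i₀⟩) • G.nodeGp e₀ := restrict_nodeGp_map hU _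
  have hR : ((H.restrictBD U' hU' bd').nodeGp Y).map U'.subtype =
      U' ⊓ ConjAct.toConjAct (H.nrep U' ⟨e', dcIdx U' (H.nodeGp e') y⟩) • H.nodeGp e' :=
    restrict_nodeGp_map hU' _
  rw [hL, hR] at hpull
  obtain ⟨u₂, hu₂, h₂⟩ := H.exists_inf_nrep_smul_eq U' e' y
  rw [h₂] at hpull
  have hmem : α.toMulEquiv.toMonoidHom (U.subtype (ConjAct.ofConjAct γ)) ∈ U' := by
    rw [← hUU']; exact ⟨_, (ConjAct.ofConjAct γ).2, rfl⟩
  refine ⟨e₀, G.nrep U ⟨e₀, i₀⟩, (α.toMulEquiv.toMonoidHom (U.subtype (ConjAct.ofConjAct γ)))⁻¹ * u₂,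
    U'.mul_mem (U'.inv_mem hmem) hu₂, ?_⟩
  rw [map_mul, map_inv, mul_smul, conjAct_smul_sup_of_normal hKn, ← hpull, Subgroup.smul_sup,
    ConjAct.ofConjAct_toConjAct, inv_smul_smul, hKn.conjAct]

include hk' in
omit [IsTopologicalGroup P] [T2Space Q] [U.FiniteIndex] [U.Normal] [CompactSpace U] in
/-- **Separation of the nodes of `H_{U'}` modulo `(ker f')↑`** from Prop. 1.2 (i) for the compactified
covering `(H_{U'}).compactifyAlong f'` (`EdgeLikeOpenInterDeterminesEdge`, at its nodes, BY NAME).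
[cite: MochizukiCombGC2007, Prop 1.2(i) p.8] -/
theorem sep_nodes_mod_of_edgeLikeOpenInter_compactifyAlong
    (hE : ((H.restrictBD U' hU' bd').compactifyAlong f' hf' hs').EdgeLikeOpenInterDeterminesEdge)
    {m₁ : H.graph.N} {y₁ : P'} {m₂ : H.graph.N} {y₂ : P'}
    (h : ∃ u' ∈ U', (U' ⊓ ConjAct.toConjAct y₁ • H.nodeGp m₁) ⊔ f'.ker.map U'.subtype =
      ConjAct.toConjAct u' • ((U' ⊓ ConjAct.toConjAct y₂ • H.nodeGp m₂) ⊔ f'.ker.map U'.subtype)) :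
    (⟨m₁, DoubleCoset.mk U' (H.nodeGp m₁) y₁⟩ :
        Σ m, DoubleCoset.Quotient (U' : Set P') (H.nodeGp m : Set P')) =
      ⟨m₂, DoubleCoset.mk U' (H.nodeGp m₂) y₂⟩ := by
  have hKn : (f'.ker.map U'.subtype).Normal := map_subtype_ker_normal H U' hU' bd' hk'
  obtain ⟨u', hu', h⟩ := h
  obtain ⟨u₁, hu₁, h₁⟩ := H.exists_inf_nrep_smul_eq U' m₁ y₁
  obtain ⟨u₂, hu₂, h₂⟩ := H.exists_inf_nrep_smul_eq U' m₂ y₂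
  have hP : ∀ X : (H.restrictGraphBD U' bd').N,
      ((((H.restrictBD U' hU' bd').nodeGp X).map f').comap f').map U'.subtype =
        (U' ⊓ ConjAct.toConjAct (H.nrep U' X) • H.nodeGp X.1) ⊔ f'.ker.map U'.subtype := by
    intro X
    rw [pullF_map, restrictBD_nodeGp, restrict_nodeGp_map]
  have hgU' : u₁ * u' * u₂⁻¹ ∈ U' := U'.mul_mem (U'.mul_mem hu₁ hu') (U'.inv_mem hu₂)
  have hrel : ((((H.restrictBD U' hU' bd').nodeGp ⟨m₁, dcIdx U' (H.nodeGp m₁) y₁⟩).map f').comap f').map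
        U'.subtype =
      ((ConjAct.toConjAct (f' ⟨u₁ * u' * u₂⁻¹, hgU'⟩) •
        ((H.restrictBD U' hU' bd').nodeGp ⟨m₂, dcIdx U' (H.nodeGp m₂) y₂⟩).map f').comap f').map
          U'.subtype := by
    rw [pullF_conj, hP, hP]
    change (U' ⊓ ConjAct.toConjAct (H.nrep U' ⟨m₁, dcIdx U' (H.nodeGp m₁) y₁⟩) • H.nodeGp m₁) ⊔ _ =
      ConjAct.toConjAct (u₁ * u' * u₂⁻¹) •
        ((U' ⊓ ConjAct.toConjAct (H.nrep U' ⟨m₂, dcIdx U' (H.nodeGp m₂) y₂⟩) • H.nodeGp m₂) ⊔ _)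
    rw [h₁, h₂, ← conjAct_smul_sup_of_normal hKn, h, ← conjAct_smul_sup_of_normal hKn, ← mul_smul,
      ← mul_smul, ← map_mul, ← map_mul]
    congr 2
    group
  have heq := pullF_injective U' f' hs' hrel
  have hX : (Sum.inl ⟨m₁, dcIdx U' (H.nodeGp m₁) y₁⟩ :
      (H.restrictGraphBD U' bd').N ⊕ ((H.restrictBD U' hU' bd').compactifyAlong f' hf' hs').graph.C) =
        Sum.inl ⟨m₂, dcIdx U' (H.nodeGp m₂) y₂⟩ := by
    refine hE _ _ 1 (ConjAct.toConjAct (f' ⟨u₁ * u' * u₂⁻¹, hgU'⟩)) ?_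
    exact isOpen_subgroupOf_inf_of_eq (by rw [one_smul]; exact heq)
  have hX' := Sum.inl_injective hX
  have hw : m₁ = m₂ := congrArg Sigma.fst hX'
  subst hw
  have hidx : dcIdx U' (H.nodeGp m₁) y₁ = dcIdx U' (H.nodeGp m₁) y₂ := eq_of_heq (Sigma.mk.inj_iff.mp hX').2
  have hmk : DoubleCoset.mk U' (H.nodeGp m₁) y₁ = DoubleCoset.mk U' (H.nodeGp m₁) y₂ :=
    (dcEnum U' (H.nodeGp m₁)).injective hidx
  rw [hmk]

end Level

end PSCDatum

end Literature.AnabelianGeometry.SemiGraphs
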